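import Literature.Combinatorics.Enumerative.HafnianExpansion
import Mathlib.Algebra.MvPolynomial.PDeriv
import Mathlib.RingTheory.MvPolynomial.Homogeneous
import HarnessLib

/-!
# The hafnian as a Gaussian derivative: `∂^{2N} exp(½ αᵗ A α) / ∂α_{μ₁} ⋯ ∂α_{μ_{2N}} |_{α = 0} = Haf(A_S)`

Topic `Literature/Combinatorics/Enumerative`, sequel of `Hafnian.lean` / `HafnianExpansion.lean`.
The step from a Gaussian state to the hafnian in the founding papers of Gaussian boson sampling
is the evaluation, at the origin, of a mixed partial derivative of the exponential of a quadratic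
form: for a symmetric `2M × 2M` matrix `A`, distinct indices `μ₁, …, μ_{2N}` (photon numbers
`n_j ∈ {0,1}`) and `A_S` the submatrix of `A` on those rows and columns,

  "`Pr(n̄) = (1/(n̄! √|σ_Q|)) ∏_{j=1}^{M} (∂²/∂α_j ∂α_j^*)^{n_j} exp[½ α_vᵗ A α_v] |_{α_v = 0}`" and
  "the expansion of the `2N` derivatives leads to a summation over all perfect matching permutations
  (PMP) … `Σ_{μ' ∈ PMP} ∏_{j=1}^{N} (A_S)_{μ'(2j−1), μ'(2j)}`.  The sum over all PMP is exactly the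
  hafnian of `A_S`, as defined by Caianiello" [cite: HamiltonEtAl2017, eqs. (4)–(6)];
  "When calculating the derivatives of `αᵗ_ν A α_ν` … we find that, as it is a quadratic function of
  `α_ν`, all derivatives of third order or higher vanish.  In addition, since we evaluate the
  derivatives at `α_ν = 0`, all derivatives of first order also vanish.  We are therefore only left
  with the partitions where the `2N` elements are sorted into `N` sets, each of size 2 … known as
  the perfect matching permutations (PMP) … `Pr(n̄) = (1/(n̄! √|σ_Q|)) Haf(A_S)`"
  [cite: KruseEtAl2019, §III eqs. (7)–(12)].

This file proves that identity as exact algebra over any commutative (semi)ring, with the formal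
variables `α_ν` modelled by `MvPolynomial W R` (`W` a finite linearly ordered index type, e.g. the
`2M` entries of `α_v = (α_1, …, α_M, α_1^*, …, α_M^*)`), the exponential replaced by its Taylor
polynomial (only the term `q^N / N!` of `exp q` has a non-zero `2N`-th derivative at the origin,
which is the content of the Kruse et al. sentence quoted above and of `coeff_sqfree_quadForm_pow_eq_zero`
below), and the hafnian being the tree's `hafnian` (sum over perfect matchings of `∏ A v (τ v)`,
`Hafnian.lean`).

(pub-qadeq lane context, CLAIMS rows E-11…E-15 and E-72 — the Gaussian-boson-sampling advantage
claims, whose scored quantities are `|Haf|²`-type click/photon-pattern probabilities; this file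
supplies the DERIVATION STEP "Gaussian state ⇒ hafnian" that `Hafnian.lean`'s docstring quotes.
HONEST FRAMING: instance-level adjudication of specific advantage claims; no claim about BQP vs BPP
or the summit — this file is commutative algebra and says nothing about any experiment, covariance
matrix or sampling cost.)

## Contents (all proved, 0 named facts)

* `sqfree S` — the exponent vector `Σ_{v∈S} e_v` of the square-free monomial `∏_{v∈S} x_v`
  (collision-free patterns `n_j ∈ {0,1}`); `quadForm A = Σ_u Σ_v A u v · x_u x_v` (the form
  `αᵗ A α`); `subMat A S` — the submatrix `A_S` on the rows and columns in `S`.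
* `hafnian_submatrix_equiv` — the hafnian is invariant under an order-preserving re-indexing
  ("the hafnian of the matrix does not change under a simultaneous permutation of rows and
  columns" [cite: BarvinokDA2017, §4.3], here only for ORDER-isomorphisms, which is what the
  restriction to sub-patterns needs); `hafnian_subMat_eq_sum` — the expansion of `Haf(A_S)` along
  any `s ∈ S` for symmetric `A` (Barvinok's (4.3.1) transported to `A_S`).
* **`coeff_sqfree_quadForm_pow`** — for symmetric `A` and `|S| = 2N`, the coefficient of
  `∏_{v∈S} x_v` in `(αᵗ A α)^N` is `2^N · N! · Haf(A_S)`; `coeff_sqfree_quadForm_pow_eq_zero` — it is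
  `0` in `(αᵗAα)^k` for `|S| ≠ 2k` (degree count: the quoted "third order or higher vanish … first
  order also vanish"); **`coeff_sqfree_half_quadForm_pow`** — with the printed `½`:
  the coefficient of `∏_{v∈S} x_v` in `(½ αᵗ A α)^N` is `N! · Haf(A_S)`.
* `iterPderiv l` — the mixed partial derivative `∂_{μ₁} ⋯ ∂_{μ_k}` (Mathlib's `MvPolynomial.pderiv`
  iterated along a list); `coeff_iterPderiv` / `constantCoeff_iterPderiv` — for distinct indices,
  evaluating `∂_{μ₁}⋯∂_{μ_k} p` at the origin returns the coefficient of `x_{μ₁}⋯x_{μ_k}` in `p`.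
* **`constantCoeff_iterPderiv_half_quadForm_pow`** — `∂^{2N}(½αᵗAα)^N/∂α_{μ₁}⋯∂α_{μ_{2N}} |₀ =
  N! · Haf(A_S)`, and `= 0` for the other powers; **`constantCoeff_iterPderiv_truncExp`** — over a
  `ℚ`-algebra, for the Taylor polynomial `exp_K(q) = Σ_{k ≤ K} q^k/k!` with `K ≥ N`:
  `∂^{2N} exp_K(½ αᵗ A α)/∂α_{μ₁}⋯∂α_{μ_{2N}} |_{α=0} = Haf(A_S)` — eqs. (4)→(6) of
  [cite: HamiltonEtAl2017, eqs. (4)–(6)] / (7)→(12) of [cite: KruseEtAl2019, §III eqs. (7)–(12)]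
  for collision-free patterns; `constantCoeff_iterPderiv_truncExp_of_odd` — an odd number of
  distinct derivatives gives `0`.

Not covered: patterns with `n_j ≥ 2` (repeated rows/columns, [cite: KruseEtAl2019, §III.A]) —
`TODO(general form)`: the coefficient of a non-square-free monomial is a hafnian of a matrix with
repeated indices divided by `∏ n_j!`; the analytic exponential / Gaussian integral itself (the
Husimi-function derivation of eq. (4), the prefactor `1/√|σ_Q|`), Isserlis'/Wick's theorem for
Gaussian random vectors [cite: Isserlis1918, §1–§3], and anything about states, covariance
matrices, threshold detectors or sampling cost.
-/

namespace Literature.Combinatorics.Enumerative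

open Finset MvPolynomial

namespace HafnianGeneratingFunction

variable {W : Type*} [Fintype W] [DecidableEq W] [LinearOrder W] {R : Type*} [CommSemiring R]

/-! ### Re-indexing the hafnian along an order isomorphism -/

omit [LinearOrder W] in
/-- Conjugating by a bijection preserves "fixed-point-free involution".
[cite: BarvinokDA2017, §4.3 (simultaneous permutation of rows and columns)] -/
theorem permCongr_mem_perfectMatchings_iff {W' : Type*} [Fintype W'] [DecidableEq W']
    (e : W' ≃ W) (τ : Equiv.Perm W') :
    e.permCongr τ ∈ perfectMatchings W ↔ τ ∈ perfectMatchings W' := by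
  simp only [mem_perfectMatchings, Equiv.permCongr_apply, Equiv.symm_apply_apply]
  constructor
  · rintro ⟨h1, h2⟩
    refine ⟨fun v => ?_, fun v => ?_⟩
    · exact e.injective (by simpa using h1 (e v))
    · intro h
      exact h2 (e v) (by simpa using congrArg e h)
  · rintro ⟨h1, h2⟩
    refine ⟨fun v => by simp [h1], fun v => ?_⟩
    intro h
    apply h2 (e.symm v)
    exact e.injective (by simpa using h)

/-- **The hafnian does not change under an order-preserving simultaneous re-indexing of rows and
columns**: `Haf(A ∘ (e × e)) = Haf(A)` for a strictly monotone bijection `e`.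
[cite: BarvinokDA2017, §4.3 ("the hafnian of the matrix does not change under a simultaneous permutation of rows and columns"; order-preserving case)] -/
theorem hafnian_submatrix_equiv {W' : Type*} [Fintype W'] [DecidableEq W'] [LinearOrder W']
    (e : W' ≃ W) (he : StrictMono e) (A : Matrix W W R) :
    hafnian (A.submatrix e e) = hafnian A := by
  unfold hafnian
  refine Finset.sum_equiv e.permCongr (fun τ => (permCongr_mem_perfectMatchings_iff e τ).symm)
    (fun τ _ => ?_)
  refine Finset.prod_equiv e (fun v => ?_) (fun v _ => ?_)
  · simp only [Finset.mem_filter, Finset.mem_univ, true_and, Equiv.permCongr_apply,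
      Equiv.symm_apply_apply]
    exact (he.lt_iff_lt).symm
  · simp [Matrix.submatrix_apply]

/-! ### Square-free exponent vectors and the submatrix on a set of indices -/

/-- `sqfree S = Σ_{v ∈ S} e_v`: the exponent vector of the square-free monomial `∏_{v ∈ S} α_v`
(one derivative `∂/∂α_v` per index `v ∈ S`, i.e. photon numbers `n_j ∈ {0,1}`).
[cite: HamiltonEtAl2017, eq. (4) (the case `n_j ∈ {0,1}`)] -/
noncomputable def sqfree (S : Finset W) : W →₀ ℕ := ∑ v ∈ S, Finsupp.single v 1

omit [Fintype W] [LinearOrder W] in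
/-- `sqfree S` is the indicator of `S`. [cite: HamiltonEtAl2017, eq. (4)] -/
theorem sqfree_apply (S : Finset W) (v : W) : sqfree S v = if v ∈ S then 1 else 0 := by
  unfold sqfree
  rw [Finsupp.finsetSum_apply]
  simp_rw [Finsupp.single_apply]
  rw [Finset.sum_ite_eq']

omit [Fintype W] [LinearOrder W] in
/-- The support of `sqfree S` is `S`. [cite: HamiltonEtAl2017, eq. (4)] -/
theorem support_sqfree (S : Finset W) : (sqfree S).support = S := by
  ext v
  rw [Finsupp.mem_support_iff, sqfree_apply]
  split_ifs with h <;> simp [h]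

omit [Fintype W] [DecidableEq W] [LinearOrder W] in
/-- The total degree of `∏_{v∈S} α_v` is `|S|`. [cite: HamiltonEtAl2017, eq. (4) ("`2N` derivatives")] -/
theorem degree_sqfree (S : Finset W) : (sqfree S).degree = S.card := by
  unfold sqfree
  rw [map_sum]
  simp [Finsupp.degree_single]

omit [Fintype W] [LinearOrder W] in
/-- Removing one index: `sqfree (S ∖ {s}) + e_s = sqfree S` for `s ∈ S`.
[cite: KruseEtAl2019, §III (one derivative at a time)] -/
theorem sqfree_erase_add {S : Finset W} {s : W} (hs : s ∈ S) :
    sqfree (S.erase s) + Finsupp.single s 1 = sqfree S :=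
  Finset.sum_erase_add S (fun v => Finsupp.single v 1) hs

omit [Fintype W] [LinearOrder W] in
/-- `sqfree S − e_s = sqfree (S ∖ {s})` for `s ∈ S`. [cite: KruseEtAl2019, §III] -/
theorem sqfree_sub_single {S : Finset W} {s : W} (hs : s ∈ S) :
    sqfree S - Finsupp.single s 1 = sqfree (S.erase s) := by
  rw [← sqfree_erase_add hs, add_tsub_cancel_right]

omit [Fintype W] [LinearOrder W] in
/-- Adding a new index: `sqfree (insert v T) = e_v + sqfree T` for `v ∉ T`.
[cite: KruseEtAl2019, §III] -/
theorem sqfree_insert {T : Finset W} {v : W} (hv : v ∉ T) :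
    sqfree (insert v T) = Finsupp.single v 1 + sqfree T :=
  Finset.sum_insert hv

omit [Fintype W] [DecidableEq W] [LinearOrder W] in
/-- `sqfree ∅ = 0`. [cite: KruseEtAl2019, §III] -/
@[simp] theorem sqfree_empty : sqfree (∅ : Finset W) = 0 := by
  simp [sqfree]

/-- The submatrix `A_S` of `A` on the rows and columns indexed by `S` ("the `2N` derivatives select
the rows/columns of `A` where the photons were measured; the other rows/columns will be
discarded … the submatrix `A_S`"). [cite: HamiltonEtAl2017, eq. (5) (definition of `A_S`)] -/
abbrev subMat (A : Matrix W W R) (S : Finset W) : Matrix S S R :=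
  A.submatrix Subtype.val Subtype.val

omit [Fintype W] in
/-- The `0 × 0` hafnian: `Haf(A_∅) = 1`. [cite: BarvinokDA2017, §4.3 (empty product)] -/
theorem hafnian_subMat_empty (A : Matrix W W R) : hafnian (subMat A ∅) = 1 := by
  haveI : IsEmpty (↥(∅ : Finset W)) := ⟨fun x => Finset.notMem_empty _ x.2⟩
  exact HafnianExpansion.hafnian_of_isEmpty _

omit [Fintype W] in
/-- Crossing out the rows/columns `s, v` of `A_S` gives (an order-isomorphic copy of)
`A_{S ∖ {s,v}}`: the two hafnians agree.
[cite: BarvinokDA2017, §4.3 (the matrix `A_j`)] -/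
theorem hafnian_minor_subMat (A : Matrix W W R) {S : Finset W} {s v : W} (hs : s ∈ S)
    (hv : v ∈ S) :
    hafnian (HafnianExpansion.minor (subMat A S) ⟨s, hs⟩ ⟨v, hv⟩) =
      hafnian (subMat A ((S.erase s).erase v)) := by
  -- the order isomorphism `(S ∖ {s}) ∖ {v} ≃ {x : S // x ≠ s ∧ x ≠ v}`
  let e : ↥((S.erase s).erase v) ≃ HafnianExpansion.Compl2 (⟨s, hs⟩ : ↥S) ⟨v, hv⟩ :=
    { toFun := fun x =>
        ⟨⟨x.1, Finset.mem_of_mem_erase (Finset.mem_of_mem_erase x.2)⟩,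
          fun h => (Finset.mem_erase.mp (Finset.mem_of_mem_erase x.2)).1 (congrArg Subtype.val h),
          fun h => (Finset.mem_erase.mp x.2).1 (congrArg Subtype.val h)⟩
      invFun := fun y =>
        ⟨y.1.1, Finset.mem_erase.mpr ⟨fun h => y.2.2 (Subtype.ext h),
          Finset.mem_erase.mpr ⟨fun h => y.2.1 (Subtype.ext h), y.1.2⟩⟩⟩
      left_inv := fun x => rfl
      right_inv := fun y => rfl }
  have he : StrictMono e := fun x y h => h
  rw [← hafnian_submatrix_equiv e he]
  rfl

omit [Fintype W] in
/-- **Expansion of `Haf(A_S)` along a vertex `s ∈ S`** for symmetric `A`: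
`Haf(A_S) = Σ_{v ∈ S, v ≠ s} A s v · Haf(A_{S ∖ {s,v}})` — Barvinok's recurrence (4.3.1) for the
submatrix. [cite: BarvinokDA2017, §4.3 eq. (4.3.1)] -/
theorem hafnian_subMat_eq_sum (A : Matrix W W R) (hA : A.IsSymm) {S : Finset W} {s : W}
    (hs : s ∈ S) :
    hafnian (subMat A S) =
      ∑ v ∈ S.erase s, A s v * hafnian (subMat A ((S.erase s).erase v)) := by
  rw [HafnianExpansion.hafnian_eq_sum_mul_hafnian_minor (subMat A S) (hA.submatrix _) ⟨s, hs⟩]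
  refine Finset.sum_bij' (fun b _ => (b : W)) (fun v hv => ⟨v, Finset.mem_of_mem_erase hv⟩)
    ?_ ?_ ?_ ?_ ?_
  · intro b hb
    exact Finset.mem_erase.mpr ⟨fun h => (Finset.mem_erase.mp hb).1 (Subtype.ext h), b.2⟩
  · intro v hv
    exact Finset.mem_erase.mpr ⟨fun h => (Finset.mem_erase.mp hv).1 (congrArg Subtype.val h),
      Finset.mem_univ _⟩
  · intro b hb
    rfl
  · intro v hv
    rfl
  · intro b hb
    simp only [Matrix.submatrix_apply]
    rw [hafnian_minor_subMat]

/-! ### The quadratic form `αᵗ A α` and its derivatives -/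

/-- The quadratic form `αᵗ A α = Σ_u Σ_v A u v · α_u α_v` as a polynomial in the formal variables
`α_v`, `v ∈ W`. [cite: KruseEtAl2019, §III eq. (7) (the exponent `½ αᵗ_ν A α_ν`)] -/
noncomputable def quadForm (A : Matrix W W R) : MvPolynomial W R :=
  ∑ u, ∑ v, C (A u v) * X u * X v

omit [DecidableEq W] [LinearOrder W] in
/-- `αᵗ A α` is homogeneous of degree `2` ("a quadratic function of `α_ν`").
[cite: KruseEtAl2019, §III (after eq. (10))] -/
theorem isHomogeneous_quadForm (A : Matrix W W R) : (quadForm A).IsHomogeneous 2 := by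
  unfold quadForm
  refine IsHomogeneous.sum _ _ _ fun u _ => IsHomogeneous.sum _ _ _ fun v _ => ?_
  exact (isHomogeneous_C_mul_X (A u v) u).mul (isHomogeneous_X R v)

omit [LinearOrder W] in
/-- **First derivatives of the quadratic form**: `∂(αᵗAα)/∂α_s = Σ_v (A s v + A v s) α_v`.
[cite: KruseEtAl2019, §III (derivatives of `αᵗ_ν A α_ν`, eqs. (9)–(10))] -/
theorem pderiv_quadForm (A : Matrix W W R) (s : W) :
    pderiv s (quadForm A) = ∑ v, C (A s v + A v s) * X v := by
  have h : ∀ u v : W, pderiv s (C (A u v) * X u * X v) =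
      (if u = s then C (A u v) * X v else 0) + (if v = s then C (A u v) * X u else 0) := by
    intro u v
    rw [mul_assoc, pderiv_C_mul, pderiv_mul, pderiv_X, pderiv_X, mul_add]
    congr 1
    · by_cases hu : u = s
      · subst hu; simp
      · simp [hu]
    · by_cases hv : v = s
      · subst hv; simp
      · simp [hv]
  calc pderiv s (quadForm A)
      = ∑ u, ∑ v, pderiv s (C (A u v) * X u * X v) := by
        unfold quadForm
        rw [map_sum]
        exact Finset.sum_congr rfl fun u _ => map_sum _ _ _
    _ = ∑ u, ∑ v, ((if u = s then C (A u v) * X v else 0)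
          + (if v = s then C (A u v) * X u else 0)) :=
        Finset.sum_congr rfl fun u _ => Finset.sum_congr rfl fun v _ => h u v
    _ = (∑ u, ∑ v, if u = s then C (A u v) * X v else 0)
          + ∑ u, ∑ v, (if v = s then C (A u v) * X u else 0) := by
        rw [← Finset.sum_add_distrib]
        exact Finset.sum_congr rfl fun u _ => Finset.sum_add_distrib
    _ = (∑ v, C (A s v) * X v) + ∑ u, C (A u s) * X u := by
        congr 1
        · rw [Finset.sum_comm]
          refine Finset.sum_congr rfl fun v _ => ?_
          rw [Finset.sum_ite_eq' Finset.univ s (fun u => C (A u v) * X v), if_pos (Finset.mem_univ _)]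
        · refine Finset.sum_congr rfl fun u _ => ?_
          rw [Finset.sum_ite_eq' Finset.univ s (fun v => C (A u v) * X u), if_pos (Finset.mem_univ _)]
    _ = ∑ v, C (A s v + A v s) * X v := by
        rw [← Finset.sum_add_distrib]
        exact Finset.sum_congr rfl fun v _ => by rw [map_add, add_mul]

omit [LinearOrder W] in
/-- For a SYMMETRIC matrix: `∂(αᵗAα)/∂α_s = Σ_v 2 A s v · α_v`.
[cite: KruseEtAl2019, §III ("As `A` is a symmetric matrix")] -/
theorem pderiv_quadForm_of_isSymm (A : Matrix W W R) (hA : A.IsSymm) (s : W) :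
    pderiv s (quadForm A) = ∑ v, C (2 * A s v) * X v := by
  rw [pderiv_quadForm]
  refine Finset.sum_congr rfl fun v _ => ?_
  rw [hA.apply v s, two_mul]

/-! ### The coefficient of `∏_{v∈S} α_v` in the powers of `αᵗ A α` -/

omit [DecidableEq W] [LinearOrder W] in
/-- **Degree count**: the square-free monomial `∏_{v∈S} α_v` has coefficient `0` in `(αᵗAα)^k`
unless `|S| = 2k` ("all derivatives of third order or higher vanish … all derivatives of first
order also vanish": only `N` pairs survive `2N` derivatives). [cite: KruseEtAl2019, §III (paragraph after eq. (10))] -/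
theorem coeff_sqfree_quadForm_pow_eq_zero (A : Matrix W W R) {S : Finset W} {k : ℕ}
    (h : S.card ≠ 2 * k) : coeff (sqfree S) (quadForm A ^ k) = 0 := by
  refine ((isHomogeneous_quadForm A).pow k).coeff_eq_zero ?_
  rw [degree_sqfree]
  exact h

/-- **The coefficient of `∏_{v ∈ S} α_v` in `(αᵗ A α)^N` is `2^N · N! · Haf(A_S)`** for a symmetric
matrix `A` and `|S| = 2N` — the combinatorial heart of "the expansion of the `2N` derivatives leads
to a summation over all perfect matching permutations": proved by induction on `N`, one derivative
`∂/∂α_s` at a time, against Barvinok's expansion of `Haf(A_S)` along `s`.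
[cite: HamiltonEtAl2017, eqs. (4)–(6)] [cite: KruseEtAl2019, §III eqs. (9)–(12)] -/
theorem coeff_sqfree_quadForm_pow (A : Matrix W W R) (hA : A.IsSymm) :
    ∀ (N : ℕ) (S : Finset W), S.card = 2 * N →
      coeff (sqfree S) (quadForm A ^ N) = 2 ^ N * (N.factorial : R) * hafnian (subMat A S)
  | 0, S, h => by
      have hS : S = ∅ := Finset.card_eq_zero.mp (by simpa using h)
      subst hS
      simp [hafnian_subMat_empty]
  | N + 1, S, h => by
      obtain ⟨s, hs⟩ : S.Nonempty := Finset.card_pos.mp (by omega)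
      -- one derivative `∂/∂α_s`: the coefficient of `x_S` in `p` is that of `x_{S∖s}` in `∂_s p`
      have key : coeff (sqfree S) (quadForm A ^ (N + 1)) =
          coeff (sqfree (S.erase s)) (pderiv s (quadForm A ^ (N + 1))) := by
        rw [coeff_pderiv, sqfree_erase_add hs, sqfree_apply]
        simp
      rw [key, pderiv_pow, pderiv_quadForm_of_isSymm A hA s, Nat.add_sub_cancel,
        ← map_natCast C, mul_assoc, coeff_C_mul, Finset.mul_sum, coeff_sum]
      -- each term: `coeff x_{S∖s} (Q^N · 2 A s v · x_v)`
      have hterm : ∀ v : W, coeff (sqfree (S.erase s)) (quadForm A ^ N * (C (2 * A s v) * X v)) =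
          if v ∈ S.erase s then 2 * A s v * coeff (sqfree ((S.erase s).erase v)) (quadForm A ^ N)
          else 0 := by
        intro v
        rw [show quadForm A ^ N * (C (2 * A s v) * X v) = C (2 * A s v) * (X v * quadForm A ^ N)
          by ring, coeff_C_mul, coeff_X_mul', support_sqfree]
        split_ifs with hv
        · rw [sqfree_sub_single hv]
        · rw [mul_zero]
      simp_rw [hterm]
      rw [Finset.sum_ite_mem, Finset.univ_inter]
      -- induction hypothesis on `S ∖ {s, v}`, `|S ∖ {s,v}| = 2N`
      have hIH : ∀ v ∈ S.erase s, coeff (sqfree ((S.erase s).erase v)) (quadForm A ^ N) =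
          2 ^ N * (N.factorial : R) * hafnian (subMat A ((S.erase s).erase v)) := by
        intro v hv
        refine coeff_sqfree_quadForm_pow A hA N _ ?_
        rw [Finset.card_erase_of_mem hv, Finset.card_erase_of_mem hs, h]
        omega
      rw [Finset.sum_congr rfl fun v hv => by rw [hIH v hv], hafnian_subMat_eq_sum A hA hs,
        Finset.mul_sum, Finset.mul_sum]
      refine Finset.sum_congr rfl fun v _ => ?_
      push_cast [Nat.factorial_succ]
      ring

/-- **With the printed factor `½`**: for symmetric `A`, `|S| = 2N` and any `c` with `2c = 1`, the
coefficient of `∏_{v∈S} α_v` in `(c · αᵗ A α)^N` is `N! · Haf(A_S)` — i.e. the term `(½αᵗAα)^N/N!`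
of `exp(½ αᵗ A α)` carries exactly `Haf(A_S) · ∏_{v∈S} α_v`.
[cite: HamiltonEtAl2017, eqs. (4)–(6)] [cite: KruseEtAl2019, §III eqs. (7), (11)–(12)] -/
theorem coeff_sqfree_half_quadForm_pow (A : Matrix W W R) (hA : A.IsSymm) {c : R}
    (hc : 2 * c = 1) {N : ℕ} {S : Finset W} (h : S.card = 2 * N) :
    coeff (sqfree S) ((C c * quadForm A) ^ N) = (N.factorial : R) * hafnian (subMat A S) := by
  rw [mul_pow, ← map_pow, coeff_C_mul, coeff_sqfree_quadForm_pow A hA N S h, ← mul_assoc,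
    ← mul_assoc, ← mul_pow, mul_comm c 2, hc, one_pow, one_mul]

omit [DecidableEq W] [LinearOrder W] in
/-- The `½`-version of the degree count: coefficient `0` unless `|S| = 2k`.
[cite: KruseEtAl2019, §III (paragraph after eq. (10))] -/
theorem coeff_sqfree_half_quadForm_pow_eq_zero (A : Matrix W W R) (c : R) {S : Finset W} {k : ℕ}
    (h : S.card ≠ 2 * k) : coeff (sqfree S) ((C c * quadForm A) ^ k) = 0 := by
  rw [mul_pow, ← map_pow, coeff_C_mul, coeff_sqfree_quadForm_pow_eq_zero A h, mul_zero]

/-! ### Mixed partial derivatives at the origin -/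

/-- The mixed partial derivative `∂_{μ₁} ∂_{μ₂} ⋯ ∂_{μ_k} p` along a list of indices
`l = [μ₁, …, μ_k]` (Mathlib's `MvPolynomial.pderiv`, iterated).
[cite: HamiltonEtAl2017, eq. (4) (the operator `∏_j (∂²/∂α_j∂α_j^*)^{n_j}`)] -/
noncomputable def iterPderiv (l : List W) (p : MvPolynomial W R) : MvPolynomial W R :=
  l.foldr (fun v q => pderiv v q) p

omit [Fintype W] [DecidableEq W] [LinearOrder W] in
/-- No derivative. [cite: HamiltonEtAl2017, eq. (4)] -/
@[simp] theorem iterPderiv_nil (p : MvPolynomial W R) : iterPderiv [] p = p := rfl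

omit [Fintype W] [DecidableEq W] [LinearOrder W] in
/-- One more derivative. [cite: HamiltonEtAl2017, eq. (4)] -/
@[simp] theorem iterPderiv_cons (v : W) (l : List W) (p : MvPolynomial W R) :
    iterPderiv (v :: l) p = pderiv v (iterPderiv l p) := rfl

omit [Fintype W] [DecidableEq W] [LinearOrder W] in
/-- `iterPderiv l` is additive. [cite: HamiltonEtAl2017, eq. (4)] -/
theorem iterPderiv_add (l : List W) (p q : MvPolynomial W R) :
    iterPderiv l (p + q) = iterPderiv l p + iterPderiv l q := by
  induction l with
  | nil => rfl
  | cons v l ih => simp [ih]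

omit [Fintype W] [DecidableEq W] [LinearOrder W] in
/-- `iterPderiv l` commutes with constant factors. [cite: HamiltonEtAl2017, eq. (4)] -/
theorem iterPderiv_C_mul (l : List W) (a : R) (p : MvPolynomial W R) :
    iterPderiv l (C a * p) = C a * iterPderiv l p := by
  induction l with
  | nil => rfl
  | cons v l ih => simp [ih]

omit [Fintype W] [DecidableEq W] [LinearOrder W] in
/-- `iterPderiv l` commutes with finite sums. [cite: HamiltonEtAl2017, eq. (4)] -/
theorem iterPderiv_sum {ι : Type*} (l : List W) (t : Finset ι) (f : ι → MvPolynomial W R) :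
    iterPderiv l (∑ i ∈ t, f i) = ∑ i ∈ t, iterPderiv l (f i) := by
  classical
  induction t using Finset.induction_on with
  | empty =>
    simp only [Finset.sum_empty]
    induction l with
    | nil => rfl
    | cons v l ih => simp [ih]
  | insert i t hi ih => rw [Finset.sum_insert hi, Finset.sum_insert hi, iterPderiv_add, ih]

omit [Fintype W] [LinearOrder W] in
/-- **Coefficients of a mixed derivative along DISTINCT indices**:
`coeff_m (∂_{μ₁}⋯∂_{μ_k} p) = coeff_{m + Σ e_{μ_i}} (p) · ∏_i (m(μ_i) + 1)`.
[cite: KruseEtAl2019, §III eq. (9) (expansion of the derivatives)] -/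
theorem coeff_iterPderiv (l : List W) (hl : l.Nodup) (p : MvPolynomial W R) (m : W →₀ ℕ) :
    coeff m (iterPderiv l p) = coeff (m + sqfree l.toFinset) p * ∏ v ∈ l.toFinset, ((m v : R) + 1) := by
  induction l generalizing m with
  | nil => simp
  | cons v l ih =>
    have hv : v ∉ l.toFinset := by simpa using (List.nodup_cons.mp hl).1
    rw [iterPderiv_cons, coeff_pderiv, ih (List.nodup_cons.mp hl).2, List.toFinset_cons,
      Finset.prod_insert hv, sqfree_insert hv, ← add_assoc]
    have hprod : ∏ w ∈ l.toFinset, (((m + Finsupp.single v 1 : W →₀ ℕ) w : R) + 1) =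
        ∏ w ∈ l.toFinset, ((m w : R) + 1) := by
      refine Finset.prod_congr rfl fun w hw => ?_
      rw [Finsupp.add_apply, Finsupp.single_eq_of_ne (ne_of_mem_of_not_mem hw hv), add_zero]
    rw [hprod]
    ring

omit [Fintype W] [LinearOrder W] in
/-- **Evaluation at the origin**: for distinct indices, `∂_{μ₁}⋯∂_{μ_k} p |_{α = 0}` is the
coefficient of `∏_i α_{μ_i}` in `p` ("the `2N` derivatives select the rows/columns").
[cite: HamiltonEtAl2017, eqs. (4)–(5)] -/
theorem constantCoeff_iterPderiv (l : List W) (hl : l.Nodup) (p : MvPolynomial W R) :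
    constantCoeff (iterPderiv l p) = coeff (sqfree l.toFinset) p := by
  rw [constantCoeff_eq, coeff_iterPderiv l hl p 0]
  simp

omit [Fintype W] [LinearOrder W] in
/-- A list of distinct indices has `|l.toFinset| = l.length` entries. [folklore] -/
private theorem card_toFinset_of_nodup {l : List W} (hl : l.Nodup) : l.toFinset.card = l.length :=
  List.toFinset_card_of_nodup hl

/-- **`∂^{2N} (½αᵗAα)^N / ∂α_{μ₁}⋯∂α_{μ_{2N}} |_{α=0} = N! · Haf(A_S)`** for symmetric `A`, distinct
indices `μ₁,…,μ_{2N}` and `S = {μ₁,…,μ_{2N}}` (any `c` with `2c = 1` standing for `½`).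
[cite: HamiltonEtAl2017, eqs. (4)–(6)] [cite: KruseEtAl2019, §III eqs. (7)–(12)] -/
theorem constantCoeff_iterPderiv_half_quadForm_pow (A : Matrix W W R) (hA : A.IsSymm) {c : R}
    (hc : 2 * c = 1) {l : List W} (hl : l.Nodup) {N : ℕ} (hN : l.length = 2 * N) :
    constantCoeff (iterPderiv l ((C c * quadForm A) ^ N)) =
      (N.factorial : R) * hafnian (subMat A l.toFinset) := by
  rw [constantCoeff_iterPderiv l hl]
  exact coeff_sqfree_half_quadForm_pow A hA hc (by rw [card_toFinset_of_nodup hl, hN])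

omit [LinearOrder W] in
/-- The other powers contribute nothing at the origin: for distinct indices with `|l| ≠ 2k`,
`∂^{|l|} (c·αᵗAα)^k / ∂α_{μ₁}⋯ |_{α=0} = 0`. [cite: KruseEtAl2019, §III (paragraph after eq. (10))] -/
theorem constantCoeff_iterPderiv_half_quadForm_pow_eq_zero (A : Matrix W W R) (c : R) {l : List W}
    (hl : l.Nodup) {k : ℕ} (hk : l.length ≠ 2 * k) :
    constantCoeff (iterPderiv l ((C c * quadForm A) ^ k)) = 0 := by
  rw [constantCoeff_iterPderiv l hl]
  exact coeff_sqfree_half_quadForm_pow_eq_zero A c (by rwa [card_toFinset_of_nodup hl])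

end HafnianGeneratingFunction

/-! ### The Taylor polynomial of the exponential over a `ℚ`-algebra -/

namespace HafnianGeneratingFunction

variable {W : Type*} [Fintype W] [DecidableEq W] [LinearOrder W]
  {R : Type*} [CommRing R] [Algebra ℚ R]

/-- The Taylor polynomial `exp_K(q) = Σ_{k=0}^{K} q^k / k!` of the exponential (enough of
`exp[½ αᵗ A α]` to carry every derivative of order `≤ 2K` at the origin).
[cite: KruseEtAl2019, §III eq. (7)] -/
noncomputable def truncExp (K : ℕ) (q : MvPolynomial W R) : MvPolynomial W R :=
  ∑ k ∈ Finset.range (K + 1), C (algebraMap ℚ R (k.factorial : ℚ)⁻¹) * q ^ k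

/-- The scalar `½` of a `ℚ`-algebra satisfies `2 · ½ = 1`. [folklore] -/
private theorem two_mul_half : (2 : R) * algebraMap ℚ R (1 / 2 : ℚ) = 1 := by
  rw [show (2 : R) = algebraMap ℚ R 2 by rw [map_ofNat], ← map_mul]
  norm_num

/-- **Hamilton–Kruse–Sansoni–Barkhofen–Silberhorn–Jex, eqs. (4)–(6) / Kruse et al. eqs. (7)–(12),
collision-free case**: for a symmetric matrix `A`, distinct indices `μ₁, …, μ_{2N}` with
`S = {μ₁, …, μ_{2N}}`, and `K ≥ N`,

  `∂^{2N} exp_K(½ αᵗ A α) / ∂α_{μ₁} ⋯ ∂α_{μ_{2N}} |_{α = 0} = Haf(A_S)`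

— "the sum over all PMP is exactly the hafnian of `A_S`".
[cite: HamiltonEtAl2017, eqs. (4)–(6)] [cite: KruseEtAl2019, §III eqs. (7)–(12)] -/
theorem constantCoeff_iterPderiv_truncExp (A : Matrix W W R) (hA : A.IsSymm) {l : List W}
    (hl : l.Nodup) {N K : ℕ} (hN : l.length = 2 * N) (hK : N ≤ K) :
    constantCoeff (iterPderiv l (truncExp K (C (algebraMap ℚ R (1 / 2 : ℚ)) * quadForm A))) =
      hafnian (subMat A l.toFinset) := by
  unfold truncExp
  rw [iterPderiv_sum, map_sum]
  rw [Finset.sum_eq_single_of_mem N (Finset.mem_range.mpr (by omega))]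
  · rw [iterPderiv_C_mul, map_mul, constantCoeff_C,
      constantCoeff_iterPderiv_half_quadForm_pow A hA two_mul_half hl hN, ← mul_assoc,
      ← map_natCast (algebraMap ℚ R), ← map_mul, inv_mul_cancel₀ (by positivity), map_one, one_mul]
  · intro k _ hk
    rw [iterPderiv_C_mul, map_mul, constantCoeff_C,
      constantCoeff_iterPderiv_half_quadForm_pow_eq_zero A _ hl (by omega), mul_zero]

omit [LinearOrder W] in
/-- An ODD number of distinct derivatives of `exp_K(c · αᵗ A α)` vanishes at the origin (no perfect
matching of an odd set). [cite: KruseEtAl2019, §III (paragraph after eq. (10))] -/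
theorem constantCoeff_iterPderiv_truncExp_of_odd (A : Matrix W W R) {l : List W}
    (hl : l.Nodup) (hodd : Odd l.length) (K : ℕ) (c : R) :
    constantCoeff (iterPderiv l (truncExp K (C c * quadForm A))) = 0 := by
  unfold truncExp
  rw [iterPderiv_sum, map_sum]
  refine Finset.sum_eq_zero fun k _ => ?_
  rw [iterPderiv_C_mul, map_mul, constantCoeff_C,
    constantCoeff_iterPderiv_half_quadForm_pow_eq_zero A c hl ?_, mul_zero]
  intro h
  exact (Nat.not_even_iff_odd.mpr hodd) ⟨k, by omega⟩

end HafnianGeneratingFunction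

/-! ### Checks -/

section Checks

open HafnianGeneratingFunction

/-- Sanity check of the conventions on the smallest case: for `W = Fin 2` and the symmetric matrix
with off-diagonal entry `a` (and any diagonal), the coefficient of `α_0 α_1` in `αᵗ A α` is `2a`
(`= 2^1 · 1! · Haf(A)`, `Haf` of a `2 × 2` matrix being its off-diagonal entry). [folklore] -/
example (a d₀ d₁ : ℤ) :
    coeff (sqfree (Finset.univ : Finset (Fin 2)))
      (quadForm (!![d₀, a; a, d₁] : Matrix (Fin 2) (Fin 2) ℤ) ^ 1) = 2 * a := by
  have hA : (!![d₀, a; a, d₁] : Matrix (Fin 2) (Fin 2) ℤ).IsSymm := by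
    ext i j; fin_cases i <;> fin_cases j <;> rfl
  rw [coeff_sqfree_quadForm_pow _ hA 1 _ (by simp)]
  -- `Haf` of the `2×2` submatrix on `univ` is `a`
  have : hafnian (subMat (!![d₀, a; a, d₁] : Matrix (Fin 2) (Fin 2) ℤ) Finset.univ) = a := by
    rw [hafnian_subMat_eq_sum _ hA (s := 0) (Finset.mem_univ _)]
    have h1 : (Finset.univ : Finset (Fin 2)).erase 0 = {1} := by decide
    rw [h1, Finset.sum_singleton]
    have h2 : (({1} : Finset (Fin 2)).erase 1) = ∅ := by decide
    rw [h2, hafnian_subMat_empty]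
    simp
  rw [this]
  simp

end Checks

end Literature.Combinatorics.Enumerative
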